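import Literature.Analysis.Complex.ArcGreenCone
import HarnessLib

/-!
# The Green function of an arc crossing a cone-annulus: the lower bound at the origin

Conclusion of the single-scale potential-theoretic estimate (`ArcGreenCone`): for a Jordan arc
`L` in the cone-annulus `{r₁ ≤ ‖z‖ ≤ r₂} ∩ {|re z| ≤ c im z}` from the outer circle (`‖e 0‖ = r₂`)
to the inner one (`‖e 1‖ = r₁`), and a radius `0 < r₀ < r₁`, the reflected difference
`q(w) = g(w̄) - g(w)` of the Green function `g = arcGreen e` satisfies

  `q(iy) ≥ κ₀ · y`  for `0 < y < r₀`,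

with `κ₀ > 0` depending ONLY on `c, r₀, r₁, r₂` (`exists_arcGreen_conj_sub_mul_I_ge`). Proof:

1. (a point near the arc) on the segment from a point `p` of the middle arc
   `{‖p‖ = r₀, im p ≥ r₀/√2}` to the final point `b = e 1 ∈ L`, let `w₁` be the first point at
   distance `δ'` from `L` (`δ'` small in terms of `c, r₀, r₁, r₂`); then
   `g(w₁) ≤ 2√(128 r₂ δ'/(r₂ - r₁)²)` (`arcGreen_le_of_near`) is below half of the uniform lower
   bound `c₃ = log 2/3^N` of `g(w̄₁)` (`le_arcGreen_of_im_nonpos`), so `q(w₁) ≥ c₃/2`;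
2. (Harnack back to the middle arc) along `[w₁, p]` the discs of radius `δ'` stay in `ℍ ∖ L`,
   where `q + ε` is locally the imaginary part of the holomorphic
   `i(Λ(w) - conj Λ'(w̄)) + iε` (logarithms of `Φ` on the disc and on its mirror image) and
   positive (`arcGreen_conj_sub_nonneg`); `harnack_chain_of_local_im` gives `q(p) ≥ m₀`;
3. (down to the origin) the half-disc comparison lemma `Complex.im_apply_mul_I_ge_of_halfDisc`
   on `{‖w‖ ≤ r₀, im w ≥ 0}`, where `q = im (i(Λ(w) - conj Λ(w̄)))` for a logarithm `Λ` of `Φ`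
   on the disc `B(0, (r₀+r₁)/2)`, yields `q(iy) ≥ (m₀/(2r₀)) y`.
-/

noncomputable section

open Set Filter Metric Topology Function Complex Bornology
open scoped unitInterval ComplexConjugate

namespace Literature.Analysis.Complex

variable {L : Set ℂ} (e : I ≃ₜ L) {c r₀ r₁ r₂ : ℝ}

/-! ### Local representation of `q` as an imaginary part -/

/-- On a disc `B(z, δ)` with `B(z, δ) ⊆ ℂ ∖ L` and `B(z̄, δ) ⊆ ℂ ∖ L`, the function
`q + ε = g ∘ conj - g + ε` is the imaginary part of a holomorphic function. [folklore] -/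
theorem exists_rep_arcGreen_conj_sub {z : ℂ} {δ : ℝ} (h₁ : ball z δ ⊆ Lᶜ)
    (h₂ : ball (conj z) δ ⊆ Lᶜ) (ε : ℝ) :
    ∃ Q : ℂ → ℂ, DifferentiableOn ℂ Q (ball z δ) ∧
      ∀ w ∈ ball z δ, (Q w).im = arcGreen e (conj w) - arcGreen e w + ε := by
  obtain ⟨Λ, hΛd, -, hΛg⟩ := exists_log_arcGreenMap_ball e h₁
  obtain ⟨Λ', hΛ'd, -, hΛ'g⟩ := exists_log_arcGreenMap_ball e h₂
  have hconj : ∀ w ∈ ball z δ, conj w ∈ ball (conj z) δ := fun w hw ↦ by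
    rw [mem_ball, dist_eq_norm] at hw ⊢
    rwa [← map_sub, Complex.norm_conj]
  have hd' : DifferentiableOn ℂ (fun w ↦ conj (Λ' (conj w))) (ball z δ) :=
    (differentiableOn_conj_conj isOpen_ball hΛ'd).mono fun w hw ↦ hconj w hw
  refine ⟨fun w ↦ Complex.I * (Λ w - conj (Λ' (conj w))) + (ε : ℂ) * Complex.I,
    ((hΛd.sub hd').const_mul _).add (differentiableOn_const _), fun w hw ↦ ?_⟩
  rw [hΛg w hw, hΛ'g (conj w) (hconj w hw)]
  simp
  ring

/-! ### The first point at distance `δ'` from the arc on a segment ending on the arc -/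

/-- **First approach to distance `δ'`**: on the segment from `p` (at distance `> δ'` from the
compact `L`) to a point `b ∈ L`, there is a first parameter `s₁ ∈ (0, 1]` where the distance to
`L` equals `δ'`; before it the distance exceeds `δ'`. [folklore] -/
theorem exists_first_infDist_eq {K : Set ℂ} {p b : ℂ} (hb : b ∈ K) {δ' : ℝ}
    (hδ' : 0 ≤ δ') (hp : δ' < infDist p K) :
    ∃ s₁ ∈ Ioc (0 : ℝ) 1, infDist (AffineMap.lineMap p b s₁) K = δ' ∧
      ∀ s ∈ Ico (0 : ℝ) s₁, δ' < infDist (AffineMap.lineMap p b s) K := by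
  set γ : ℝ → ℂ := fun s ↦ AffineMap.lineMap p b s with hγ
  have hγc : Continuous γ := AffineMap.lineMap_continuous
  set F : ℝ → ℝ := fun s ↦ infDist (γ s) K with hF
  have hFc : Continuous F := (continuous_infDist_pt K).comp hγc
  set S : Set ℝ := {s | s ∈ Icc (0 : ℝ) 1 ∧ F s ≤ δ'} with hS
  have hScl : IsClosed S := by
    have : S = Icc (0 : ℝ) 1 ∩ F ⁻¹' Iic δ' := by ext s; simp [hS]
    rw [this]
    exact isClosed_Icc.inter (isClosed_Iic.preimage hFc)
  have h1S : (1 : ℝ) ∈ S := by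
    refine ⟨⟨zero_le_one, le_rfl⟩, ?_⟩
    show infDist (γ 1) K ≤ δ'
    rw [hγ]; dsimp only
    rw [AffineMap.lineMap_apply_one, infDist_zero_of_mem hb]
    exact hδ'
  have hSne : S.Nonempty := ⟨1, h1S⟩
  have hSbdd : BddBelow S := ⟨0, fun s hs ↦ hs.1.1⟩
  set s₁ : ℝ := sInf S with hs₁
  have hs₁S : s₁ ∈ S := hScl.csInf_mem hSne hSbdd
  have hs₁le : s₁ ≤ 1 := csInf_le hSbdd h1S
  have h0 : F 0 > δ' := by
    show infDist (γ 0) K > δ'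
    rw [hγ]; dsimp only
    rwa [AffineMap.lineMap_apply_zero]
  have hs₁pos : 0 < s₁ := by
    rcases hs₁S.1.1.eq_or_lt with h | h
    · exfalso
      have := hs₁S.2
      rw [← h] at this
      linarith
    · exact h
  have hbefore : ∀ s ∈ Ico (0 : ℝ) s₁, δ' < F s := by
    intro s hs
    by_contra hle
    rw [not_lt] at hle
    have hsS : s ∈ S := ⟨⟨hs.1, hs.2.le.trans hs₁le⟩, hle⟩
    exact (not_le.2 hs.2) (csInf_le hSbdd hsS)
  refine ⟨s₁, ⟨hs₁pos, hs₁le⟩, le_antisymm hs₁S.2 ?_, hbefore⟩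
  -- `F s₁ ≥ δ'` by continuity from the left
  have hcl : s₁ ∈ closure (Ico (0 : ℝ) s₁) := by
    rw [closure_Ico hs₁pos.ne]; exact ⟨hs₁pos.le, le_rfl⟩
  have hsub : Ico (0 : ℝ) s₁ ⊆ F ⁻¹' Ici δ' := fun s hs ↦ (hbefore s hs).le
  exact (closure_minimal hsub (isClosed_Ici.preimage hFc)) hcl

/-! ### The lower bound on the middle arc and at the origin -/

/-- Points of the segment `[w₁, p]`, `w₁ = lineMap p b s₁`, are of the form `lineMap p b s`,
`s ∈ [0, s₁]`. [folklore] -/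
theorem mem_segment_lineMap {p b : ℂ} {s₁ : ℝ} (hs₁ : 0 ≤ s₁) {z : ℂ}
    (hz : z ∈ segment ℝ (AffineMap.lineMap p b s₁ : ℂ) p) :
    ∃ s ∈ Icc (0 : ℝ) s₁, z = AffineMap.lineMap p b s := by
  rw [segment_symm, segment_eq_image_lineMap] at hz
  obtain ⟨t, ht, rfl⟩ := hz
  refine ⟨t * s₁, ⟨mul_nonneg ht.1 hs₁, by nlinarith [ht.2]⟩, ?_⟩
  simp only [AffineMap.lineMap_apply_module]
  simp only [Complex.real_smul]
  push_cast
  ring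

section Config

variable (hc : 0 < c) (hr₀ : 0 < r₀) (hr₀₁ : r₀ < r₁) (hr₁₂ : r₁ < r₂)
  (hL : ∀ z ∈ L, r₁ ≤ ‖z‖ ∧ ‖z‖ ≤ r₂ ∧ |z.re| ≤ c * z.im)
  (ha : ‖((e 0 : L) : ℂ)‖ = r₂) (hb : ‖((e 1 : L) : ℂ)‖ = r₁)
include hc hr₀ hr₀₁ hr₁₂ hL ha hb

/-- **The point near the arc.** From a point `p` of the middle arc, moving straight towards the
final point `b = e 1` of the arc, the first point `w₁` at distance `δ'` from `L` has
`‖w₁‖ ≤ r₁`, `im w₁ ≥ r₁/√(1+c²) - δ'`, `q(w₁) ≥ c₃/2`, and the segment `[w₁, p]` stays at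
distance `≥ δ'` from `L` — for `δ'` small as quantified. [folklore] -/
theorem exists_nearPoint {c₃ : ℝ} (hc₃ : c₃ = Real.log 2 / 3 ^ ⌈24 * r₂ * Real.sqrt (1 + c ^ 2) / r₁⌉₊)
    {δ' : ℝ} (hδ'pos : 0 < δ') (hδ'₁ : δ' ≤ (r₂ - r₁) ^ 2 / (512 * r₂))
    (hδ'₂ : δ' ≤ c₃ ^ 2 * (r₂ - r₁) ^ 2 / (2048 * r₂)) (hδ'₄ : δ' ≤ r₁ / Real.sqrt (1 + c ^ 2) / 4)
    (hδ'₅ : δ' ≤ (r₁ - r₀) / 2) {p : ℂ} (hpn : ‖p‖ = r₀) :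
    ∃ w₁ : ℂ, ‖w₁‖ ≤ r₁ ∧ r₁ / Real.sqrt (1 + c ^ 2) - δ' ≤ w₁.im ∧ w₁ ∉ L ∧
      c₃ / 2 ≤ arcGreen e (conj w₁) - arcGreen e w₁ ∧
      ∀ z ∈ segment ℝ w₁ p, δ' ≤ infDist z L := by
  have hr₁ : 0 < r₁ := hr₀.trans hr₀₁
  have hr₂ : 0 < r₂ := hr₁.trans hr₁₂
  obtain ⟨Δ, hΔ, hΔpos⟩ : ∃ Δ : ℝ, Δ = r₂ - r₁ ∧ 0 < Δ := ⟨_, rfl, by linarith⟩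
  rw [← hΔ] at hδ'₁ hδ'₂
  obtain ⟨hgt, hhgt, hhgtpos⟩ : ∃ h : ℝ, h = r₁ / Real.sqrt (1 + c ^ 2) ∧ 0 < h := ⟨_, rfl, by positivity⟩
  rw [← hhgt] at hδ'₄ ⊢
  have hc₃pos : 0 < c₃ := by rw [hc₃]; exact div_pos (Real.log_pos (by norm_num)) (by positivity)
  set a : ℂ := ((e 0 : L) : ℂ) with hadef
  set b : ℂ := ((e 1 : L) : ℂ) with hbdef
  have hLc : IsCompact L := isCompact_arc e
  have hLhgt : ∀ z ∈ L, hgt ≤ z.im := fun z hz ↦ by rw [hhgt]; exact im_ge_of_mem_cone hc hL hz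
  have hbL : b ∈ L := (e 1).2
  have hLsub : L ⊆ closedBall a (2 * r₂) := subset_closedBall_endpoint e hL ha
  -- `p` is farther than `δ'` from `L`
  have hpdist : δ' < infDist p L := by
    have h1 : r₁ - r₀ ≤ infDist p L := by
      rw [le_infDist ⟨b, hbL⟩]
      intro x hx
      rw [dist_comm, dist_eq_norm]
      have := norm_sub_norm_le x p
      rw [hpn] at this
      linarith only [this, (hL x hx).1]
    linarith only [h1, hδ'₅, hr₀₁]
  -- the first point at distance `δ'`
  obtain ⟨s₁, hs₁, hdist₁, hbefore⟩ := exists_first_infDist_eq hbL hδ'pos.le hpdist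
  set w₁ : ℂ := AffineMap.lineMap p b s₁ with hw₁
  obtain ⟨x₁, hx₁L, hx₁d⟩ := hLc.exists_infDist_eq_dist ⟨b, hbL⟩ w₁
  have hwx : ‖w₁ - x₁‖ = δ' := by rw [← dist_eq_norm, ← hx₁d, hdist₁]
  have hw₁L : w₁ ∉ L := fun h ↦ by
    have := infDist_zero_of_mem h
    rw [hdist₁] at this
    exact hδ'pos.ne' this
  have hw₁n : ‖w₁‖ ≤ r₁ := by
    rw [hw₁, AffineMap.lineMap_apply_module]
    calc ‖(1 - s₁) • p + s₁ • b‖ ≤ ‖(1 - s₁) • p‖ + ‖s₁ • b‖ := norm_add_le _ _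
      _ = (1 - s₁) * r₀ + s₁ * r₁ := by
          rw [norm_smul, norm_smul, Real.norm_eq_abs, Real.norm_eq_abs, abs_of_nonneg (by linarith [hs₁.2]),
            abs_of_nonneg hs₁.1.le, hpn, hb]
      _ ≤ (1 - s₁) * r₁ + s₁ * r₁ := by gcongr; linarith [hs₁.2]
      _ = r₁ := by ring
  have hw₁im : hgt - δ' ≤ w₁.im := by
    have h1 := hLhgt x₁ hx₁L
    have h2 : |w₁.im - x₁.im| ≤ δ' := by
      rw [← Complex.sub_im, ← hwx]; exact Complex.abs_im_le_norm _
    linarith only [h1, (abs_le.1 h2).1]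
  have hw₁a : Δ ≤ ‖w₁ - a‖ := by
    have := norm_sub_norm_le a w₁
    rw [ha, norm_sub_rev] at this
    linarith only [this, hw₁n, hΔ]
  have hx₁a : Δ / 2 ≤ ‖x₁ - a‖ := by
    have := norm_sub_norm_le (w₁ - a) (w₁ - x₁)
    rw [hwx, show w₁ - a - (w₁ - x₁) = x₁ - a by ring] at this
    have hδ'Δ : δ' ≤ Δ / 2 := by
      refine hδ'₁.trans ?_
      rw [div_le_div_iff₀ (by positivity) (by norm_num)]
      have : Δ ≤ r₂ := by rw [hΔ]; linarith
      nlinarith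
    linarith only [this, hw₁a, hδ'Δ]
  have hx₁ne : x₁ ≠ a := fun h ↦ by
    rw [h, sub_self, norm_zero] at hx₁a
    linarith only [hx₁a, hΔpos]
  -- segment property (before making `w₁` opaque)
  have hseg_dist : ∀ z ∈ segment ℝ w₁ p, δ' ≤ infDist z L := by
    intro z hz
    obtain ⟨s₀, hs₀, rfl⟩ := mem_segment_lineMap hs₁.1.le hz
    rcases hs₀.2.eq_or_lt with h | h
    · rw [h]; exact hdist₁.ge
    · exact (hbefore s₀ ⟨hs₀.1, h⟩).le
  clear_value w₁
  refine ⟨w₁, hw₁n, hw₁im, hw₁L, ?_, hseg_dist⟩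
  -- `g(w₁)` is small …
  have hprod : Δ * (Δ / 2) ≤ ‖w₁ - a‖ * ‖x₁ - a‖ := mul_le_mul hw₁a hx₁a (by positivity) (norm_nonneg _)
  have hprodpos : 0 < ‖w₁ - a‖ * ‖x₁ - a‖ := lt_of_lt_of_le (by positivity) hprod
  have hD : 32 * (2 * r₂) * ‖w₁ - x₁‖ / (‖w₁ - a‖ * ‖x₁ - a‖) ≤ 128 * r₂ * δ' / Δ ^ 2 := by
    rw [hwx, div_le_div_iff₀ hprodpos (by positivity)]
    calc 32 * (2 * r₂) * δ' * Δ ^ 2 = 128 * r₂ * δ' * (Δ * (Δ / 2)) := by ring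
      _ ≤ 128 * r₂ * δ' * (‖w₁ - a‖ * ‖x₁ - a‖) := by gcongr
  have hsmall : 32 * (2 * r₂) * ‖w₁ - x₁‖ / (‖w₁ - a‖ * ‖x₁ - a‖) ≤ 1 / 4 := by
    refine hD.trans ?_
    rw [div_le_iff₀ (by positivity)]
    have := mul_le_mul_of_nonneg_left hδ'₁ (by positivity : (0 : ℝ) ≤ 128 * r₂)
    have h2 : 128 * r₂ * (Δ ^ 2 / (512 * r₂)) = 1 / 4 * Δ ^ 2 := by field_simp; ring
    linarith only [this, h2]
  have hgw₁ : arcGreen e w₁ ≤ c₃ / 2 := by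
    have h1 := arcGreen_le_of_near e (R := 2 * r₂) (by positivity) hLsub hw₁L hx₁L hx₁ne hsmall
    refine h1.trans ?_
    have h2 : Real.sqrt (32 * (2 * r₂) * ‖w₁ - x₁‖ / (‖w₁ - a‖ * ‖x₁ - a‖)) ≤ c₃ / 4 := by
      rw [Real.sqrt_le_left (by positivity)]
      refine hD.trans ?_
      rw [div_le_iff₀ (by positivity)]
      have := mul_le_mul_of_nonneg_left hδ'₂ (by positivity : (0 : ℝ) ≤ 128 * r₂)
      have h3 : 128 * r₂ * (c₃ ^ 2 * Δ ^ 2 / (2048 * r₂)) = (c₃ / 4) ^ 2 * Δ ^ 2 := by field_simp; ring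
      linarith only [this, h3]
    linarith only [h2]
  -- … while `g(w̄₁)` is not
  have hgcw₁ : c₃ ≤ arcGreen e (conj w₁) := by
    have h1 := le_arcGreen_of_im_nonpos e hc hr₁ hr₁₂ hL ha (p := conj w₁)
      (by rw [Complex.conj_im]; linarith only [hw₁im, hδ'₄, hhgtpos]) (by rw [Complex.norm_conj]; linarith only [hw₁n, hr₁₂])
    rwa [← hc₃] at h1
  linarith only [hgw₁, hgcw₁]

/-- **The lower bound on the middle arc** `{‖p‖ = r₀, im p ≥ r₀/√2}`: `q(p) ≥ c₃/2/3^{n₂}`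
(Harnack chain from the near point of `exists_nearPoint`, for `q + ε`, `ε ↓ 0`). [folklore] -/
theorem le_arcGreen_conj_sub_of_midarc {c₃ : ℝ}
    (hc₃ : c₃ = Real.log 2 / 3 ^ ⌈24 * r₂ * Real.sqrt (1 + c ^ 2) / r₁⌉₊)
    {δ' : ℝ} (hδ'pos : 0 < δ') (hδ'₁ : δ' ≤ (r₂ - r₁) ^ 2 / (512 * r₂))
    (hδ'₂ : δ' ≤ c₃ ^ 2 * (r₂ - r₁) ^ 2 / (2048 * r₂)) (hδ'₃ : δ' ≤ r₀ / 2)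
    (hδ'₄ : δ' ≤ r₁ / Real.sqrt (1 + c ^ 2) / 4)
    (hδ'₅ : δ' ≤ (r₁ - r₀) / 2) {n₂ : ℕ} (hn₂ : 4 * r₁ / δ' ≤ n₂) {p : ℂ} (hpn : ‖p‖ = r₀)
    (hpim : r₀ / Real.sqrt 2 ≤ p.im) :
    c₃ / 2 / 3 ^ n₂ ≤ arcGreen e (conj p) - arcGreen e p := by
  have hr₁ : 0 < r₁ := hr₀.trans hr₀₁
  have hLH : ∀ z ∈ L, 0 < z.im := fun z hz ↦ im_pos_of_mem_cone hc hr₁ hL hz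
  obtain ⟨w₁, hw₁n, hw₁im, -, hqw₁, hseg_dist⟩ :=
    exists_nearPoint e hc hr₀ hr₀₁ hr₁₂ hL ha hb hc₃ hδ'pos hδ'₁ hδ'₂ hδ'₄ hδ'₅ hpn
  have hsqrt2 : Real.sqrt 2 < 2 := (Real.sqrt_lt' (by norm_num)).2 (by norm_num)
  have hsqrt2pos : 0 < Real.sqrt 2 := Real.sqrt_pos.2 (by norm_num)
  have hhgtpos : 0 < r₁ / Real.sqrt (1 + c ^ 2) := by positivity
  obtain ⟨hmin, hhmin, hminδ⟩ : ∃ hmin : ℝ, hmin = min (r₀ / Real.sqrt 2) (r₁ / Real.sqrt (1 + c ^ 2) - δ') ∧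
      δ' < hmin := by
    refine ⟨_, rfl, lt_min ?_ (by linarith only [hδ'₄, hhgtpos])⟩
    have : r₀ / 2 < r₀ / Real.sqrt 2 := div_lt_div_of_pos_left hr₀ hsqrt2pos hsqrt2
    linarith only [this, hδ'₃]
  have hseg_im : ∀ z ∈ segment ℝ w₁ p, hmin ≤ z.im := by
    intro z hz
    rw [segment_eq_image_lineMap] at hz
    obtain ⟨t, ht, rfl⟩ := hz
    rw [AffineMap.lineMap_apply_module, Complex.add_im, Complex.smul_im, Complex.smul_im, smul_eq_mul,
      smul_eq_mul]
    have h1 : hmin ≤ w₁.im := by rw [hhmin]; exact (min_le_right _ _).trans hw₁im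
    have h2 : hmin ≤ p.im := by rw [hhmin]; exact (min_le_left _ _).trans hpim
    nlinarith only [h1, h2, ht.1, ht.2]
  have hloc : ∀ ε : ℝ, 0 < ε → ∀ z ∈ segment ℝ w₁ p, ∃ Q : ℂ → ℂ, DifferentiableOn ℂ Q (ball z δ') ∧
      (∀ w ∈ ball z δ', (Q w).im = arcGreen e (conj w) - arcGreen e w + ε) ∧
      ∀ w ∈ ball z δ', 0 < arcGreen e (conj w) - arcGreen e w + ε := by
    intro ε hε z hz
    have hzim := hseg_im z hz
    have hzd := hseg_dist z hz
    have h₁ : ball z δ' ⊆ Lᶜ := fun w hw hwL ↦ by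
      have := infDist_le_dist_of_mem hwL (x := z)
      rw [dist_comm] at this
      exact (not_lt.2 (hzd.trans this)) hw
    have h₂ : ball (conj z) δ' ⊆ Lᶜ := fun w hw hwL ↦ by
      have h3 := hLH w hwL
      rw [mem_ball, dist_eq_norm] at hw
      have h4 := Complex.abs_im_le_norm (w - conj z)
      rw [Complex.sub_im, Complex.conj_im] at h4
      have h5 := (abs_lt.1 (lt_of_le_of_lt h4 hw)).2
      linarith only [h3, h5, hzim, hminδ]
    obtain ⟨Q, hQd, hQim⟩ := exists_rep_arcGreen_conj_sub e h₁ h₂ ε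
    refine ⟨Q, hQd, hQim, fun w hw ↦ ?_⟩
    have hwim : 0 ≤ w.im := by
      rw [mem_ball, dist_eq_norm] at hw
      have h4 := Complex.abs_im_le_norm (w - z)
      rw [Complex.sub_im] at h4
      have h5 := (abs_lt.1 (lt_of_le_of_lt h4 hw)).1
      linarith only [h5, hzim, hminδ]
    linarith only [arcGreen_conj_sub_nonneg e hLH hwim, hε]
  have hn₂' : ‖p - w₁‖ ≤ n₂ * (δ' / 2) := by
    have h1 : ‖p - w₁‖ ≤ 2 * r₁ := by
      calc ‖p - w₁‖ ≤ ‖p‖ + ‖w₁‖ := norm_sub_le _ _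
        _ ≤ r₀ + r₁ := by rw [hpn]; linarith only [hw₁n]
        _ ≤ 2 * r₁ := by linarith only [hr₀₁]
    have h3 : 2 * r₁ ≤ (n₂ : ℝ) * (δ' / 2) := by
      calc 2 * r₁ = 4 * r₁ / δ' * (δ' / 2) := by field_simp; ring
        _ ≤ n₂ * (δ' / 2) := by gcongr
    linarith only [h1, h3]
  refine le_of_forall_pos_le_add fun ε hε ↦ ?_
  have hchain := harnack_chain_of_local_im (u := fun w ↦ arcGreen e (conj w) - arcGreen e w + ε)
    hδ'pos (hloc ε hε) hn₂'
  have h1 : c₃ / 2 / 3 ^ n₂ ≤ (arcGreen e (conj w₁) - arcGreen e w₁ + ε) / 3 ^ n₂ := by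
    gcongr; linarith only [hqw₁, hε]
  have h2 : (arcGreen e (conj p) - arcGreen e p + ε) ≤ arcGreen e (conj p) - arcGreen e p + ε := le_rfl
  linarith only [h1, hchain]

end Config

/-- **Uniform lower bound for `q` at the origin, through the middle arc.** For
`0 < r₀ < r₁ < r₂` and `0 < c` there is `κ₀ > 0` such that for every Jordan arc `L` in the
cone-annulus from the outer circle to the inner one, `q(iy) ≥ κ₀ y` for `0 < y < r₀`, where
`q = g ∘ conj - g`, `g = arcGreen e`. [folklore] -/
theorem exists_arcGreen_conj_sub_mul_I_ge (hc : 0 < c) (hr₀ : 0 < r₀) (hr₀₁ : r₀ < r₁)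
    (hr₁₂ : r₁ < r₂) :
    ∃ κ₀ : ℝ, 0 < κ₀ ∧ ∀ {L : Set ℂ} (e : I ≃ₜ L),
      (∀ z ∈ L, r₁ ≤ ‖z‖ ∧ ‖z‖ ≤ r₂ ∧ |z.re| ≤ c * z.im) → ‖((e 0 : L) : ℂ)‖ = r₂ →
      ‖((e 1 : L) : ℂ)‖ = r₁ → ∀ y : ℝ, 0 < y → y < r₀ →
        κ₀ * y ≤ arcGreen e (conj ((y : ℂ) * Complex.I)) - arcGreen e ((y : ℂ) * Complex.I) := by
  have hr₁ : 0 < r₁ := hr₀.trans hr₀₁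
  have hr₂ : 0 < r₂ := hr₁.trans hr₁₂
  have hΔpos : 0 < r₂ - r₁ := by linarith only [hr₁₂]
  have hhgtpos : 0 < r₁ / Real.sqrt (1 + c ^ 2) := by positivity
  -- the constants (opaque)
  obtain ⟨c₃, hc₃, hc₃pos⟩ : ∃ c₃ : ℝ, c₃ = Real.log 2 / 3 ^ ⌈24 * r₂ * Real.sqrt (1 + c ^ 2) / r₁⌉₊ ∧ 0 < c₃ :=
    ⟨_, rfl, div_pos (Real.log_pos (by norm_num)) (by positivity)⟩
  obtain ⟨δ', hδ'pos, hδ'₁, hδ'₂, hδ'₃, hδ'₄, hδ'₅⟩ : ∃ δ' : ℝ, 0 < δ' ∧ δ' ≤ (r₂ - r₁) ^ 2 / (512 * r₂) ∧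
      δ' ≤ c₃ ^ 2 * (r₂ - r₁) ^ 2 / (2048 * r₂) ∧ δ' ≤ r₀ / 2 ∧ δ' ≤ r₁ / Real.sqrt (1 + c ^ 2) / 4 ∧
      δ' ≤ (r₁ - r₀) / 2 := by
    refine ⟨min (min ((r₂ - r₁) ^ 2 / (512 * r₂)) (c₃ ^ 2 * (r₂ - r₁) ^ 2 / (2048 * r₂)))
      (min (min (r₀ / 2) (r₁ / Real.sqrt (1 + c ^ 2) / 4)) ((r₁ - r₀) / 2)), ?_, ?_, ?_, ?_, ?_, ?_⟩
    · refine lt_min (lt_min (by positivity) ?_) (lt_min (lt_min (by positivity) (by positivity)) (by linarith only [hr₀₁]))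
      exact div_pos (mul_pos (pow_pos hc₃pos 2) (pow_pos hΔpos 2)) (by positivity)
    · exact (min_le_left _ _).trans (min_le_left _ _)
    · exact (min_le_left _ _).trans (min_le_right _ _)
    · exact (min_le_right _ _).trans ((min_le_left _ _).trans (min_le_left _ _))
    · exact (min_le_right _ _).trans ((min_le_left _ _).trans (min_le_right _ _))
    · exact (min_le_right _ _).trans (min_le_right _ _)
  obtain ⟨n₂, hn₂⟩ : ∃ n₂ : ℕ, 4 * r₁ / δ' ≤ n₂ := ⟨_, Nat.le_ceil _⟩
  obtain ⟨m₀, hm₀, hm₀pos⟩ : ∃ m₀ : ℝ, m₀ = c₃ / 2 / 3 ^ n₂ ∧ 0 < m₀ :=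
    ⟨_, rfl, div_pos (half_pos hc₃pos) (pow_pos (by norm_num) _)⟩
  refine ⟨m₀ / (2 * r₀), by positivity, ?_⟩
  intro L e hL ha hb y hy0 hyr
  have hLH : ∀ z ∈ L, 0 < z.im := fun z hz ↦ im_pos_of_mem_cone hc hr₁ hL hz
  have hmid : ∀ p : ℂ, ‖p‖ = r₀ → r₀ / Real.sqrt 2 ≤ p.im → m₀ ≤ arcGreen e (conj p) - arcGreen e p := by
    intro p hpn hpim
    rw [hm₀]
    exact le_arcGreen_conj_sub_of_midarc e hc hr₀ hr₀₁ hr₁₂ hL ha hb hc₃ hδ'pos hδ'₁ hδ'₂ hδ'₃ hδ'₄ hδ'₅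
      hn₂ hpn hpim
  -- down to the origin by the half-disc comparison
  obtain ⟨ρ, hρ, hρ₀, hρ₁⟩ : ∃ ρ : ℝ, ρ = (r₀ + r₁) / 2 ∧ r₀ < ρ ∧ ρ < r₁ :=
    ⟨_, rfl, by linarith only [hr₀₁], by linarith only [hr₀₁]⟩
  have hball : ball (0 : ℂ) ρ ⊆ Lᶜ := fun w hw hwL ↦ by
    rw [mem_ball_zero_iff] at hw
    linarith only [hw, (hL w hwL).1, hρ₁]
  have hball' : ball (conj (0 : ℂ)) ρ ⊆ Lᶜ := by rwa [map_zero]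
  obtain ⟨Q, hQd, hQim⟩ := exists_rep_arcGreen_conj_sub e hball hball' 0
  have hsub : closedBall (0 : ℂ) r₀ ∩ {w : ℂ | 0 ≤ w.im} ⊆ ball 0 ρ := fun w hw ↦ by
    rw [mem_ball_zero_iff]
    exact lt_of_le_of_lt (mem_closedBall_zero_iff.1 hw.1) hρ₀
  have hpos : ∀ w ∈ closedBall (0 : ℂ) r₀, 0 ≤ w.im → 0 ≤ (Q w).im := fun w hw hwim ↦ by
    rw [hQim w (hsub ⟨hw, hwim⟩), add_zero]
    exact arcGreen_conj_sub_nonneg e hLH hwim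
  have hmid' : ∀ w : ℂ, ‖w‖ = r₀ → r₀ / Real.sqrt 2 ≤ w.im → m₀ ≤ (Q w).im := fun w hw hwim ↦ by
    have hwim' : 0 ≤ w.im := le_trans (by positivity) hwim
    rw [hQim w (hsub ⟨by rw [mem_closedBall_zero_iff, hw], hwim'⟩), add_zero]
    exact hmid w hw hwim
  have h := Complex.im_apply_mul_I_ge_of_halfDisc hr₀ hm₀pos.le isOpen_ball hsub hQd hpos hmid' hy0 hyr
  have hyU : ((y : ℂ) * Complex.I) ∈ ball (0 : ℂ) ρ := by
    rw [mem_ball_zero_iff, norm_mul, Complex.norm_real, Complex.norm_I, mul_one, Real.norm_eq_abs,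
      abs_of_pos hy0]
    exact hyr.trans hρ₀
  rw [hQim _ hyU, add_zero] at h
  exact h

end Literature.Analysis.Complex
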